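import Mathlib
import Summits.CriticalPhenomena.CardyFormulaZ2.Theses.CardyMagicRigidity
import Summits.CriticalPhenomena.CardyFormulaZ2.Theorems.CardyMagicRigidityNestingRigidityTransferGluing
import Literature.Probability.Percolation.FullPlaneCNL
import Literature.Probability.Percolation.FullPlaneCNLPresentation
import Literature.Probability.Percolation.LoopRepresentationProofs
import Literature.Probability.RandomPlanarGeometry.LoopConfigurationsMetric
import Literature.Probability.LatticeModels.IsoradialPercolation
import Literature.Probability.LatticeModels.TriangularLattice
import Literature.Probability.Percolation.CardyFormula
import HarnessLib

/-!
# Vocabulary of line `Sketch` (card `hex-segment-odd-channel`, the two-leg Chayes–Lei chain) for crux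
# `LoopLimitZ2EqT` (stmt-CriticalPhenomena-4833)

Route `CardyMagicRigidity` (sub-problem `CriticalPhenomena/CardyFormulaZ2`), crux
`Summit.CriticalPhenomena.CardyFormulaZ2.Theses.CardyMagicRigidity.LoopLimitZ2EqT` ≡
`d_CN((P^bond_{1/2}, bondLoopConfig δ 0), (P^site_{1/2}, siteLoopConfig δ)) → 0` as `δ → 0⁺`
(full-plane loop universality bond-`ℤ²` ~ site-`𝕋` in DKKMO's coupling distance, arXiv:2012.11672 eq. (2)).
This file is the **definitions module** of the checked skeleton `Cruxes/LoopLimitZ2EqT/Lines/Sketch.lean`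
(lead `prover-line-stmt-CriticalPhenomena-4833-0`, reshape r1, `ledger skeleton check` OK, 7 registered
stubs): it carries, sorry-free, §0 the VOCABULARY of the line, §1 the seven registered STUB STATEMENTS as
named `Prop`s, and §2 two sorry-free glue lemmas (standard Borel structure of the coin space,
measurability of the mixed exceptional event), so that the stub helper files `Theorems/CardyMagicRigidityLoopLimitZ2EqT<StubName>.lean` (each
proving `theorem stub_<name> : <Statement>` by name, `--supports stmt-CriticalPhenomena-4833`) and the
closing skeleton share ONE copy of every object. Nothing in §1 is asserted: every `def … : Prop` there is a
statement to be proved by a registered stub.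

THE LINE, at loop level (cards `hex-segment-odd-channel` ≈ `triangular-hyperlattice-segment` ≈
`lozenge-chayes-lei-chain` + `kagome-arena-track-insertion`, triage `TRIAGE-r1-{1,2}.md`):

  bond-`ℤ²`_δ ~[S4 `TriToSquareLoops`]~ bond-`𝕋̃`_δ =[S1 `BondEndLaw`]= M₁ ~[S5 ⇒ S6 ⇒ S7: flatness of
  the C₃-symmetric self-dual hyperlattice segment `M_t`]~ M₀ ~[S2 `SiteEndLoops`]~ site-`𝕋`_δ,

glued by `LoopConfig.cnLawEDist_triangle` with the measurability side conditions from S3 `CoinMeasurable`.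

Objects. `Coin`, `prm t`, `upEdge`, `cfg` (from the ideator sketch `Cruxes/LoopLimitZ2EqT/SketchIdeator2.lean`):
the segment model `M_t` lives on the product Bernoulli space of coins (per up-triangle `x` of `triGraph`:
a type bit of density `t`, a fair coin, three bond coins of density `p_c(𝕋̃) = criticalWeightI (π/6) =
2 sin(π/18)`, `StarTriangle.criticalWeight_pi_div_six`); `cfg S` opens edge `k` of a bond-type cell iff
bond coin `k` is heads and all three edges of a site-type cell iff its fair coin is heads; every `M_t` is
exactly self-dual, `M₀` = site percolation on the up-triangle lattice (arena identity), `M₁` = i.i.d.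
critical bond percolation on `𝕋̃`. NEW, the one cheap object replacing a Kagome medial-loop
construction: the HALF-MESH REFINEMENT `refine ω` of a bond configuration `ω` on `𝕋̃` — the site
configuration on `𝕋` whose open sites are the doubled original vertices `x + x` and the midpoints `x + y`
of OPEN edges `{x, y}`. In the triangular lattice on `ℤ²` (`triGraph`, neighbours `±e₀, ±e₁, ±(1,−1)`)
the points `x + y`, `x ∼ y`, are exactly the sites with an odd coordinate and the 2-refinement of `𝕋̃` is
`𝕋` itself; the open site clusters of `refine ω` met with the doubled sites are the bond clusters of `ω`,
the closed site clusters are the dual bond clusters (the three midpoints of a face are pairwise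
adjacent). Hence `triBondLoops δ ω := siteLoopConfig (δ/2) (refine ω)` is a typed loop representation of
bond percolation on `δ𝕋̃` (an `O(δ)`-deformation of the Kagome medial loops plus `O(δ)` dust around
isolated vertices — immaterial in `d_CN`, `not_isClose_of_unmatched_big_loop`), with curves, typing by
orientation and measurability inherited from the tree's `siteLoopConfig`; `segLoops δ S := triBondLoops δ (cfg S)`.
-/

noncomputable section

open MeasureTheory Set Filter Metric
open scoped Real Topology ENNReal BigOperators

namespace Summit.CriticalPhenomena.CardyFormulaZ2.Cruxes.LoopLimitZ2EqT.HexSegment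

open Literature.Probability.RandomPlanarGeometry Literature.Probability.Percolation
  Literature.Probability.LatticeModels
open _root_.Summit.CriticalPhenomena.CardyFormulaZ2.Theses.CardyMagicRigidity (LoopLimitZ2EqT)
open _root_.Summit.CriticalPhenomena.CardyFormulaZ2.Cruxes.NestingRigidity.RingCloudTomography
  (measurableSet_isClose_bond_site)

/-! ## §0 Vocabulary -/

/-- Coins of the segment model: per up-triangle `x : Site 2` of `triGraph` a type bit (`none`), a
fair coin (`some none`) and three bond coins (`some (some k)`, `k : Fin 3`). -/
abbrev Coin : Type := Site 2 × Option (Option (Fin 3))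

/-- Parameters of the product Bernoulli measure on coins: type bit `t` (density of bond-type cells),
fair coin `1/2`, bond coins `p_c(𝕋̃) = criticalWeightI (π/6) = 2 sin(π/18)`. -/
def prm (t : unitInterval) : Coin → unitInterval := fun i =>
  match i.2 with
  | none => t
  | some none => half
  | some (some _) => criticalWeightI (Real.pi / 6)

/-- The three edges of the up-triangle of `triGraph` at `x`: `{x, x+e₀}`, `{x, x+e₁}`, `{x+e₀, x+e₁}`
(every edge of `triGraph` lies in exactly one up-triangle). -/
def upEdge (x : Site 2) (k : Fin 3) : Sym2 (Site 2) :=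
  if k = 0 then s(x, x + ![1, 0]) else if k = 1 then s(x, x + ![0, 1]) else s(x + ![1, 0], x + ![0, 1])

/-- The bond configuration on `𝕋̃ = triGraph` of a coin set `S`: a bond-type cell (`(x, none) ∈ S`)
opens its edge `k` iff its bond coin `k` is heads; a site-type cell opens ALL three edges iff its fair
coin is heads. -/
def cfg (S : Set Coin) : BondConfig (Site 2) :=
  {e | ∃ (x : Site 2) (k : Fin 3), e = upEdge x k ∧
      (((x, (none : Option (Option (Fin 3)))) ∈ S ∧ (x, some (some k)) ∈ S) ∨
       ((x, (none : Option (Option (Fin 3)))) ∉ S ∧ (x, some (none : Option (Fin 3))) ∈ S))}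

/-- **Half-mesh refinement.** The site configuration on `𝕋` encoding a bond configuration `ω` on
`𝕋̃`: the doubled original vertices `x + x` are open, and the midpoint `x + y` of an edge `{x, y}` of
`triGraph` is open iff the edge is open in `ω`. (In `triGraph` the map `{x, y} ↦ x + y` is a bijection
from edges onto the sites of `ℤ²` with an odd coordinate, and the 2-refined triangular lattice is the
triangular lattice again; open site clusters of `refine ω` = bond clusters of `ω` fattened by midpoints,
closed site clusters = dual clusters.) -/
def refine (ω : BondConfig (Site 2)) : SiteConfig (Site 2) :=
  {v | ∃ x y : Site 2, v = x + y ∧ (x = y ∨ (triGraph.Adj x y ∧ s(x, y) ∈ ω))}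

/-- **Typed loop representation of bond percolation on `δ𝕋̃`** through the half-mesh refinement:
the typed honeycomb interface loops (`siteLoopConfig`, mesh `δ/2`) of `refine ω`. Original vertex `x`
sits at `(δ/2) · triEmbed (x + x) = δ · triEmbed x`, so `𝕋̃` has edge length `δ`. -/
def triBondLoops (δ : ℝ) (ω : BondConfig (Site 2)) : LoopConfig ℂ :=
  siteLoopConfig (δ / 2) (refine ω)

/-- The typed loop configuration of the segment model at mesh `δ`, as a function of the coins. -/
def segLoops (δ : ℝ) (S : Set Coin) : LoopConfig ℂ := triBondLoops δ (cfg S)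

/-- Crude crossing probability of the conformal rectangle `R` at mesh `δ` for the segment model `M_t`
(equilateral embedding `triEmbed`, generic discretisation `embDomainCrossing`). -/
def segCross (t : unitInterval) (R : ConformalRectangle) (δ : ℝ) : ℝ :=
  (prodBernoulli (prm t)).real {S | cfg S ∈ embDomainCrossing triEmbed R.carrier δ (R.arc 0) (R.arc 2)}

/-- Same, as a function of a real parameter (projected to `[0,1]`), to speak of `d/dt`. -/
def segCrossℝ (t : ℝ) (R : ConformalRectangle) (δ : ℝ) : ℝ :=
  segCross (Set.projIcc (0 : ℝ) 1 zero_le_one t) R δ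

/-! ## §1 Stub statements -/

/-- S1 **Endpoint dictionary at `t = 1` (law identity).** Under `prm 1` every cell is a.s. of bond
type, `upEdge` is a bijection `Site 2 × Fin 3 ≃ triGraph.edgeSet`, and the bond coins are i.i.d. of
density `p_c(𝕋̃)`: the law of `cfg` is i.i.d. critical bond percolation on `triGraph`. -/
def BondEndLaw : Prop :=
  (prodBernoulli (prm 1)).map cfg = bondPercolation triGraph (criticalWeightI (Real.pi / 6))

/-- S2 **Endpoint dictionary at `t = 0`, loop level (arena identity).** Under `prm 0` every cell is
a.s. of site type, the open clusters of `cfg S` are the site clusters of the fair coins on the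
up-triangle lattice (a translate of `𝕋` by `(1+ζ)/3`), and every macroscopic interface loop of
`segLoops δ S` is within `udist O(δ)` of the corresponding honeycomb loop of that site configuration;
the remaining loops are dust of diameter `O(δ)`, matched w.h.p. by the dense microscopic loops of
site-`𝕋` (`tendsto_measure_setOf_sparse_siteLoopConfig`). Conclusion in `d_CN`, against the very
presentation `(triSitePercolation half, siteLoopConfig δ)` of the crux. -/
def SiteEndLoops : Prop :=
  Tendsto (fun δ : ℝ ↦ LoopConfig.cnLawEDist (prodBernoulli (prm 0)) (segLoops δ)
    (triSitePercolation half) (siteLoopConfig δ)) (𝓝[>] 0) (𝓝 0)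

/-- S3 **Measurability of the coin maps**: `cfg` and `refine` are measurable (every coordinate of the
image is a finite Boolean combination of coordinates). Supplies the side conditions of
`cnLawEDist_triangle` / `cnLawEDist_comp_snd_le` in the composition. -/
def CoinMeasurable : Prop :=
  Measurable cfg ∧ Measurable refine

/-- S4 **Isoradial transport bond-`ℤ²` ~ bond-`𝕋̃` at loop level** (leg 1; card
`kagome-arena-track-insertion`): `d_CN` between critical bond percolation on `δℤ²` (DKKMO's typed loop
representation) and critical bond percolation on `δ𝕋̃` (typed loops through the half-mesh refinement)
tends to `0`. Literature-grade input: the announced extension of DKKMO Thm 1.7 / Manolescu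
arXiv:2502.08394 Thm 5.3 to all bi-periodic isoradial graphs ([HM24], Rem 5.6), `q = 1`, plus CLE
scale invariance for the mesh ratio; 2-direction shadow in the tree: `dkkmo_theorem_1_7` (named fact). -/
def TriToSquareLoops : Prop :=
  Tendsto (fun δ : ℝ ↦ LoopConfig.cnLawEDist (bondPercolation (zdGraph 2) half) (bondLoopConfig δ 0)
    (bondPercolation triGraph (criticalWeightI (Real.pi / 6))) (triBondLoops δ)) (𝓝[>] 0) (𝓝 0)

/-- S5 **Uniform attachment symmetry** (THE research stub of the line; card `hex-segment-odd-channel`):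
the `t`-derivative of every crude crossing probability along the segment is `o(1)` as `δ → 0⁺`,
uniformly in `t ∈ [0,1]` — equivalently the pivotal attachment asymmetry `A_t(R, δ) → 0` uniformly
(Russo: `d/dt = (1/3)·Σ_cells E_t[σ ; cell pivotal]`; the 4-arm term cancels identically by the
`S_t`-antisymmetry, `C₃` kills the modulus channel, the residual is the exactly-marginal colour-odd
five-arm coupling `k₅^odd(t)`, conjectured `≡ 0`). -/
def UniformAttachmentSymmetry : Prop :=
  ∀ R : ConformalRectangle, ∀ ε > 0, ∃ δ₀ > 0, ∀ δ ∈ Set.Ioo 0 δ₀, ∀ t ∈ Set.Icc (0 : ℝ) 1,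
    |derivWithin (fun t' : ℝ ↦ segCrossℝ t' R δ) (Set.Icc 0 1) t| < ε

/-- **Segment flatness** (crossing level): along the segment every crude crossing probability is
asymptotically independent of the bond-type density `t`. -/
def HexSegmentFlat : Prop :=
  ∀ (t : unitInterval) (R : ConformalRectangle),
    Tendsto (fun δ : ℝ ↦ segCross t R δ - segCross 0 R δ) (𝓝[>] 0) (𝓝 0)

/-- **Segment flatness at loop level** (what the chain consumes): the typed loop ensembles of `M₁`
and `M₀` merge in `d_CN`. -/
def SegmentLoops : Prop :=
  Tendsto (fun δ : ℝ ↦ LoopConfig.cnLawEDist (prodBernoulli (prm 1)) (segLoops δ)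
    (prodBernoulli (prm 0)) (segLoops δ)) (𝓝[>] 0) (𝓝 0)

/-! ## §2 Glue lemmas (sorry-free) -/

/-- `Set Coin` (a countable product of two-point spaces) is a standard Borel space. -/
theorem standardBorelSpace_coin : StandardBorelSpace (Set Coin) := by
  unfold Set
  exact StandardBorelSpace.pi_countable (α := fun _ ↦ Prop)

/-- Measurability of the exceptional event of `d_CN` between the segment loops and site-`𝕋` (from S3:
it is the preimage under `refine ∘ cfg` of the site/site event `measurableSet_isClose_siteLoopConfig`). -/
theorem measurableSet_isClose_seg_site (h : CoinMeasurable) (δ δ' ε : ℝ) :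
    MeasurableSet {p : Set Coin × SiteConfig (Site 2) |
      LoopConfig.IsClose ε (segLoops δ p.1) (siteLoopConfig δ' p.2)} := by
  have hm : Measurable (Prod.map (refine ∘ cfg) (id : SiteConfig (Site 2) → SiteConfig (Site 2))) :=
    (h.2.comp h.1).prodMap measurable_id
  exact hm (measurableSet_isClose_siteLoopConfig (δ / 2) δ' ε)

/-! ## §3 The residual statements of the line, named (continuation lead c1, 2026-08-16)

After the landings S1 (`stub_bondEnd`, p89250), S2 (`stub_siteEnd`, p95819), S3 (`stub_coinMeasurable`,
p87343), S5a (`stub_russoMixture`, p96401), S6 (`stub_flatOfSymmetry`, p90168), S7a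
(`stub_siteEndCrossings`, p103501) and the chain glue (`loopLimitZ2EqT_of_stubs`, p93819), the
registered skeleton `Cruxes/LoopLimitZ2EqT/Lines/Sketch.lean` (r6) has exactly three sorries: S4
`stub_triToSquareLoops : TriToSquareLoops` (§1), S5b `stub_influenceVanishes` and S7c `stub_cardyToCLE`,
whose statements were so far only written inline in the skeleton. They are named below — together with
the two natural intermediate statements at the bond end `t = 1` (Cardy at crossing level,
`BondEndCrossings`; merging with site-`𝕋` at loop level, `BondEndLoops`) — so that the conditional closing
theorems of `Theorems/CardyMagicRigidityLoopLimitZ2EqTConditional.lean` and the planners can refer to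
them by name. As in §1, NOTHING here is asserted: each `def … : Prop` is a statement; S5b is the line's
research content (universality along the Chayes–Lei self-dual hexagon family, open), S7c is the
Camia–Newman CLE₆ pipeline for critical bond percolation on `𝕋̃` in relative form (no published source
for `𝕋̃`; the site-`𝕋` original is the named fact `exists_isFullPlaneCNLLaw`). -/

/-- S5b **The total type influence vanishes uniformly** (sharp form of S5 `UniformAttachmentSymmetry`;
the two are equivalent by the landed Russo formula for the mixture, S5a `stub_russoMixture`, which says
that the `t`-derivative within `[0,1]` of `segCrossℝ · R δ` IS this sum): for every conformal rectangle
`R` and `ε > 0`, once `0 < δ < δ₀(ε, R)`, for EVERY `t ∈ [0,1]` the finite sum over the cells `x` of the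
type influences `P_t[F | type bit of x := 1] − P_t[F | type bit of x := 0]` on the crude crossing event
`F = {cfg ∈ embDomainCrossing triEmbed R.carrier δ (R.arc 0) (R.arc 2)}` is `< ε` in absolute value.
(By the opening lead's pivotal bookkeeping this is `(q₂ − 1/2)/P₀(t) · E_t[D] → 0`, the colour-odd
five-arm coupling `k₅^odd ≡ 0`; Monte-Carlo consistent with `0`, kit jobs j014258, j016193, j017798.)
The statement of the registered stub `stub_influenceVanishes`, verbatim. -/
def InfluenceVanishes : Prop :=
  ∀ R : ConformalRectangle, ∀ ε > 0, ∃ δ₀ > 0, ∀ δ ∈ Set.Ioo 0 δ₀, ∀ t ∈ Set.Icc (0 : ℝ) 1,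
    |∑ᶠ x : Site 2,
        ((prodBernoulli (Function.update (prm (Set.projIcc (0 : ℝ) 1 zero_le_one t))
            (x, (none : Option (Option (Fin 3)))) 1)).real
            {S : Set Coin | cfg S ∈ embDomainCrossing triEmbed R.carrier δ (R.arc 0) (R.arc 2)} -
          (prodBernoulli (Function.update (prm (Set.projIcc (0 : ℝ) 1 zero_le_one t))
            (x, (none : Option (Option (Fin 3)))) 0)).real
            {S : Set Coin | cfg S ∈ embDomainCrossing triEmbed R.carrier δ (R.arc 0) (R.arc 2)})| < ε

/-- **Cardy's formula for `M₁` at crossing level** (= critical bond percolation on `𝕋̃`, by S1): for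
every conformal rectangle the crude crossing probability `segCross 1 R δ` converges to Cardy's
`F(η)` along every uniformizing datum (`ConformalRectangle.HasCrossingLimit`). In the line it is the
OUTPUT of segment flatness (S7b: `HexSegmentFlat` + S7a) and the INPUT of S7c. The `t = 0` twin is
the landed S7a `stub_siteEndCrossings`. -/
def BondEndCrossings : Prop :=
  ∀ R : ConformalRectangle,
    R.HasCrossingLimit (segCross 1 R) Literature.Probability.RandomPlanarGeometry.cardyFunction

/-- **`M₁` merges with site-`𝕋` at loop level**: `d_CN((prodBernoulli (prm 1), segLoops δ),
(P^site_{1/2}, siteLoopConfig δ)) → 0` — the bond-end twin of S2 `SiteEndLoops`. With S4 and the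
landed S1–S3 it already gives the crux (`loopLimitZ2EqT_of_bondEndLoops` in the conditional file):
it is exactly "critical bond-`𝕋̃` and critical site-`𝕋` have the same full-plane loop limit", stated
without a continuum object. -/
def BondEndLoops : Prop :=
  Tendsto (fun δ : ℝ ↦ LoopConfig.cnLawEDist (prodBernoulli (prm 1)) (segLoops δ)
    (triSitePercolation half) (siteLoopConfig δ)) (𝓝[>] 0) (𝓝 0)

/-- S7c **Cardy ⇒ CLE₆ for `M₁`, relative form**: crossing-level Cardy for `M₁` in every conformal
rectangle implies loop-level merging with site-`𝕋`. The research-grade TECHNOLOGY statement of the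
line: Camia–Newman's full-plane theorem (CMP 268 (2006), Thms 1–6, with the exploration-path
convergence of PTRF 139 (2007)) re-run for critical bond percolation on `𝕋̃` — crude Cardy + RSW
(Grimmett–Manolescu isoradial) ⇒ exploration path → SLE₆ ⇒ full-plane loop ensemble ⇒ the
Camia–Newman law — and compared with site-`𝕋` through the uniqueness of that law up to `d_CN`
(`IsFullPlaneCNLLaw.cnLawEDist_eq_zero`). No published source treats `𝕋̃`; crux-sized. The
statement of the registered stub `stub_cardyToCLE`, by name. -/
def CardyToCLE : Prop :=
  BondEndCrossings → BondEndLoops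

end Summit.CriticalPhenomena.CardyFormulaZ2.Cruxes.LoopLimitZ2EqT.HexSegment

end
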